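import Summits.BirchSwinnertonDyer.Rank1Residual.GaloisImage.KolyvaginPrimeLocalShape
import Literature.NumberTheory.GaloisRepresentations.ContinuousCohomologyConnectingNaturality
import Literature.NumberTheory.GaloisRepresentations.LocalFieldCdTwo
import Literature.NumberTheory.EllipticCurves.KummerSequenceConnecting
import HarnessLib

/-!
# Dévissage of Milne I Thm. 4.10(b) — local inputs at an unramified place

For a short exact sequence `0 → M₁ → M₂ → M₃ → 0` of finite discrete `Γ_F`-modules over a
non-archimedean local field `F` on which the INERTIA group acts trivially:

* `isSES_invariantsHom` — the invariants under `N = Gal(F̄/F^nr)` form a short exact sequence of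
  discrete `Γ_F/N`-modules (all three modules are `N`-trivial);
* `exists_mem_unramifiedSubgroup_map_eq` — **`H¹_ur(F, M₂) → H¹_ur(F, M₃)` is onto**: an unramified
  class of `M₃` is inflated from `Γ_F/N ≅ Ẑ` (inflation–restriction), lifts there because
  `H²(Γ_F/N, M₁) = 0` (`cd(Ẑ) = 1`, `subsingleton_two_quotient_galUnr_of_finite`), and the inflation
  of the lift is unramified;
* `map_mem_unramifiedSubgroup` — `H¹(f)` maps unramified classes to unramified classes;
* `exists_sub_map_mem_unramifiedSubgroup` — if `H¹(g) m` is unramified then `m ≡ H¹(f) a`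
  modulo `H¹_ur(F, M₂)` for some `a ∈ H¹(F, M₁)`;
* `δ₁_eq_zero_of_mem_unramifiedSubgroup` — the connecting map kills `H¹_ur(F, M₃)`.

These are the local facts at the places `v ∉ S` used by the dévissage of the Poitou–Tate middle
exactness along a short exact sequence (`KolyvaginRoadThreePTDevissage*`).  Theorems only.

References: [SerreGaloisCohomology1997] I §2.6 (b), II §5.5; [MilneADT2006] I Lemma 2.9, Thm. 4.10.
-/

noncomputable section

open CategoryTheory Function
open scoped ContRepresentation

universe u

set_option linter.dupNamespace false
set_option autoImplicit false

namespace Summit.BirchSwinnertonDyer.BirchSwinnertonDyer.Theorems.KolyvaginRoadThreePT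

open Field ValuativeRel
open Literature.NumberTheory.GaloisRepresentations
open Literature.NumberTheory.GaloisRepresentations.IsNonarchimedeanLocalField
open Literature.NumberTheory.GaloisRepresentations.DiscreteGaloisModule (homOfIntertwining
  unramifiedSubgroup)
open _root_.TopRep _root_.ContRepresentation _root_.ContinuousCohomology
open Summit.BirchSwinnertonDyer.Rank1Residual.GaloisImage

section Local

variable {F : Type u} [Field F]
variable {M₁ M₂ M₃ : Type u}
  [AddCommGroup M₁] [TopologicalSpace M₁] [DiscreteTopology M₁]
  [AddCommGroup M₂] [TopologicalSpace M₂] [DiscreteTopology M₂]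
  [AddCommGroup M₃] [TopologicalSpace M₃] [DiscreteTopology M₃]
variable {ρ₁ : DiscreteGaloisModule F M₁} {ρ₂ : DiscreteGaloisModule F M₂}
  {ρ₃ : DiscreteGaloisModule F M₃}
variable {f : ρ₁.toContRepresentation →ⁱL ρ₂.toContRepresentation}
  {g : ρ₂.toContRepresentation →ⁱL ρ₃.toContRepresentation}

/-- Inertia acts trivially on `M₃` if it does on `M₂` (`g` is onto and equivariant). [folklore] -/
theorem apply_eq_self_of_surjective (h : IsSES (homOfIntertwining f) (homOfIntertwining g))
    {S : Set (absoluteGaloisGroup F)} (hI : ∀ t ∈ S, ∀ m : M₂, ρ₂ t m = m) :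
    ∀ t ∈ S, ∀ m : M₃, ρ₃ t m = m := by
  intro t ht m
  obtain ⟨y, rfl⟩ := h.surjective m
  exact (g.isIntertwining t y).symm.trans (congrArg g (hI t ht y))

/-- Inertia acts trivially on `M₁` if it does on `M₂` (`f` is injective and equivariant). [folklore] -/
theorem apply_eq_self_of_injective (h : IsSES (homOfIntertwining f) (homOfIntertwining g))
    {S : Set (absoluteGaloisGroup F)} (hI : ∀ t ∈ S, ∀ m : M₂, ρ₂ t m = m) :
    ∀ t ∈ S, ∀ m : M₁, ρ₁ t m = m := by
  intro t ht m
  apply h.injective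
  exact (f.isIntertwining t m).trans (hI t ht (f m))

/-- **The `N`-invariants of a short exact sequence of `N`-trivial discrete modules form a short exact
sequence** of discrete `Γ_F/N`-modules (`ContinuousRep.invariantsHom`). [cite: SerreGaloisCohomology1997, I §2.6] -/
theorem isSES_invariantsHom (N : Subgroup (absoluteGaloisGroup F)) [N.Normal]
    (h : IsSES (homOfIntertwining f) (homOfIntertwining g)) (hI : ∀ t ∈ N, ∀ m : M₂, ρ₂ t m = m) :
    IsSES (ContinuousRep.invariantsHom (N := N) (homOfIntertwining f))
      (ContinuousRep.invariantsHom (N := N) (homOfIntertwining g)) := by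
  refine ⟨?_, ?_, ?_, ?_⟩
  · ext x
    exact h.g_f_apply (x : M₁)
  · intro x y hxy
    exact Subtype.ext (h.injective (congrArg Subtype.val hxy))
  · intro y hy
    obtain ⟨x, hx⟩ := h.exact_mid (y : M₂) (congrArg Subtype.val hy)
    exact ⟨⟨x, fun n => apply_eq_self_of_injective h hI n n.2 x⟩, Subtype.ext hx⟩
  · intro z
    obtain ⟨y, hy⟩ := h.surjective (z : M₃)
    exact ⟨⟨y, fun n => hI n n.2 y⟩, Subtype.ext hy⟩

/-- **`H¹(f)` preserves unramified classes** (`H¹_ur = ker res_{F^{ur}}`, and restriction commutes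
with the change of coefficients). [cite: MilneADT2006, Ch. I §2 (unramified cohomology)] -/
theorem map_mem_unramifiedSubgroup [ValuativeRel F]
    (φ : ρ₁.toContRepresentation →ⁱL ρ₂.toContRepresentation) {a : galoisCohomology ρ₁ 1}
    (ha : a ∈ unramifiedSubgroup ρ₁ 1) :
    galoisCohomology.map φ 1 a ∈ unramifiedSubgroup ρ₂ 1 := by
  rw [DiscreteGaloisModule.mem_unramifiedSubgroup_iff] at ha ⊢
  rw [galoisCohomology.res_map_one, ha, map_zero]

variable [ValuativeRel F] [TopologicalSpace F] [IsNonarchimedeanLocalField F]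

/-- **`H¹_ur(F, M₂) → H¹_ur(F, M₃)` is onto** for a short exact sequence of finite discrete modules
with trivial inertia action: unramified classes are inflated from `Γ_F/N`, `N = Gal(F̄/F^nr)`
(inflation–restriction), the inflated class lifts along `H¹(Γ_F/N, M₂) → H¹(Γ_F/N, M₃)` because
`H²(Γ_F/N, M₁) = 0` (`cd(Ẑ) = 1`), and inflated classes are unramified.
[cite: SerreGaloisCohomology1997, II §5.5 (unramified cohomology), I §2.6 (b)] [cite: MilneADT2006, Ch. I, Lemma 2.9] -/
theorem exists_mem_unramifiedSubgroup_map_eq [Finite M₁]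
    (h : IsSES (homOfIntertwining f) (homOfIntertwining g))
    (hI : ∀ t ∈ absInertia F, ∀ m : M₂, ρ₂ t m = m) {b : galoisCohomology ρ₃ 1}
    (hb : b ∈ unramifiedSubgroup ρ₃ 1) :
    ∃ m ∈ unramifiedSubgroup ρ₂ 1, galoisCohomology.map g 1 m = b := by
  classical
  haveI := absoluteGaloisGroup_compactSpace F
  have hIN : ∀ t ∈ galUnr F, ∀ m : M₂, ρ₂ t m = m := fun t ht =>
    hI t (by rwa [galUnr_eq_absInertia] at ht)
  have hI₃ : ∀ t ∈ absInertia F, ∀ m : M₃, ρ₃ t m = m := apply_eq_self_of_surjective h hI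
  -- `b` is inflated from `Γ_F/N`
  obtain ⟨φb, rfl⟩ := oneCocycleClass_surjective ρ₃.toTopRep b
  have hres : resSubgroup ρ₃.toTopRep (galUnr F) 1 (oneCocycleClass ρ₃.toTopRep φb) = 0 :=
    (mem_unramifiedSubgroup_one_iff_resSubgroup_galUnr_eq_zero ρ₃ hI₃ φb).1 hb
  obtain ⟨y, hy⟩ := ((infOne_exact_resSubgroup (galUnr F) ρ₃) _).1 hres
  -- the invariant sequence over `Γ_F/N` and the vanishing of its `H²(·, M₁^N)`
  have hQ := isSES_invariantsHom (galUnr F) h hIN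
  have hδ : hQ.δ₁ y = 0 :=
    @Subsingleton.elim _ (subsingleton_two_quotient_galUnr_of_finite F (ρ₁.invariantsOf (galUnr F))
      (ρ₁.quotientInvariants (galUnr F))) _ _
  obtain ⟨y', hy'⟩ := hQ.exists_map_one_eq_of_δ₁_eq_zero y hδ
  refine ⟨infOne (galUnr F) ρ₂ y', ?_, ?_⟩
  · -- inflated classes are unramified
    obtain ⟨ψ, hψ⟩ := oneCocycleClass_surjective ρ₂.toTopRep (infOne (galUnr F) ρ₂ y')
    have key : oneCocycleClass ρ₂.toTopRep ψ ∈ unramifiedSubgroup ρ₂ 1 := by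
      rw [mem_unramifiedSubgroup_one_iff_resSubgroup_galUnr_eq_zero ρ₂ hI ψ, hψ]
      exact (infOne_exact_resSubgroup (galUnr F) ρ₂).apply_apply_eq_zero y'
    exact hψ ▸ key
  · change cohomologyMap (homOfIntertwining g) 1 (infOne (galUnr F) ρ₂ y') = _
    rw [cohomologyMap_infOne, hy', hy]

/-- **If `H¹(g) m` is unramified then `m ≡ H¹(f) a (mod H¹_ur(F, M₂))` for some `a ∈ H¹(F, M₁)`**
(surjectivity of `H¹_ur(M₂) → H¹_ur(M₃)` and exactness at `H¹(F, M₂)`). [cite: MilneADT2006, Ch. I, Lemma 2.9] -/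
theorem exists_sub_map_mem_unramifiedSubgroup [Finite M₁]
    (h : IsSES (homOfIntertwining f) (homOfIntertwining g))
    (hI : ∀ t ∈ absInertia F, ∀ m : M₂, ρ₂ t m = m) {m : galoisCohomology ρ₂ 1}
    (hm : galoisCohomology.map g 1 m ∈ unramifiedSubgroup ρ₃ 1) :
    ∃ a : galoisCohomology ρ₁ 1, m - galoisCohomology.map f 1 a ∈ unramifiedSubgroup ρ₂ 1 := by
  obtain ⟨m', hm', hgm'⟩ := exists_mem_unramifiedSubgroup_map_eq h hI hm
  have hker : galoisCohomology.map g 1 (m - m') = 0 := by rw [map_sub, hgm', sub_self]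
  obtain ⟨a, ha⟩ := h.exists_map_one_eq_of_map_one_eq_zero (m - m') hker
  refine ⟨a, ?_⟩
  have ha' : galoisCohomology.map f 1 a = m - m' := ha
  rw [ha', sub_sub_cancel]
  exact hm'

/-- **The connecting map `δ₁ : H¹(F, M₃) → H²(F, M₁)` kills the unramified classes** (they come from
unramified classes of `M₂`).  (The instance argument is `absoluteGaloisGroup_compactSpace F`, needed to
speak of `δ₁`.) [cite: MilneADT2006, Ch. I, Lemma 2.9 and Thm. 4.10] -/
theorem δ₁_eq_zero_of_mem_unramifiedSubgroup [Finite M₁] [CompactSpace (absoluteGaloisGroup F)]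
    (h : IsSES (homOfIntertwining f) (homOfIntertwining g))
    (hI : ∀ t ∈ absInertia F, ∀ m : M₂, ρ₂ t m = m) {b : galoisCohomology ρ₃ 1}
    (hb : b ∈ unramifiedSubgroup ρ₃ 1) : h.δ₁ b = 0 := by
  obtain ⟨m, -, rfl⟩ := exists_mem_unramifiedSubgroup_map_eq h hI hb
  exact h.δ₁_map_one m

end Local

end Summit.BirchSwinnertonDyer.BirchSwinnertonDyer.Theorems.KolyvaginRoadThreePT

end
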